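import Literature.NumberTheory.Rogawski1990.UnramifiedOrbitalUnitFactorEndoscopic
import Literature.NumberTheory.Rogawski1990.RegularEltLocalisation
import Literature.NumberTheory.Rogawski1990.AdelicDeltaTransfer
import Literature.NumberTheory.Automorphic.LocalEndoscopicOrbitClosed
import HarnessLib

/-!
# `G`-regularity localises on `H = U(Φ₂) × U(Φ₁)`: class representatives, the `hadm`-shape accessor, and the S-H unit factors ∕ normalisation
# read at the kit's pins (Rogawski (1990), §4.3 p. 42, §4.9 p. 54, §14.2 (14.2.1) p. 232)

Topic `NumberTheory/Rogawski1990`; namespace `Literature.NumberTheory.Rogawski1990`; THEOREMS ONLY (no definition, no instance, no named fact, no `sorry`).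
The H-side twin of ★ `RegularEltLocalisation`: the T1 line pins the endoscopic local orbital measure families `m^H_v` on the `G`-REGULAR classes
(★ `IsAdmissibleOn (IsLocalGRegular L v)`, ★ `IsCanonical (IsLocalGRegular L v) (νH v)`), while ★ S-H (`UnramifiedOrbitalUnitFactorEndoscopic`) reads
invariance at the class of `(γ_H)_v` and the predicate at `out ⟦(γ_H)_v⟧`.  In between: `G`-regularity is a class function on `H(L⁺_v)`
(★ `isGRegular_of_isStablyConjH` + ★ `isStablyConjH_of_isConj`), passes from a rational `γ_H` to its components (★ `isLocalGRegular_toLocal_of_isGRegular`)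
and forces `γ₂` regular (★ `IsGRegular.isRegularElt_fst`):

* `isLocalGRegular_of_isConj`, `isLocalGRegular_out_mk`, `isLocalGRegular_rationalComponent`, **`isLocalGRegular_out_mk_rationalComponent`**,
  `isRegularElt_fst_of_isGRegular`;
* **`isAdmissibleOn_at_rationalComponent`** — `m^H_v ⟦(γ_H)_v⟧ ≠ 0 ∧ SMulInvariantMeasure ∧ IsFiniteMeasureOnCompacts` from admissibility on the
  `G`-regular classes (the H-side `hadm` shape);
* **`exists_finset_forall_atPoint_rationalComponent_eq_one_of_isCanonical_isLocalGRegular`** — canonical `m^H_v` for `(IsLocalGRegular, νH_v)` with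
  `νH_v(K_{H,v}) = 1` are normalised at `(γ_H)_v` off a finite set, for `γ_H` rational `G`-regular (no `hP`, no separate `γ₂`-regularity);
* **`exists_finset_forall_classOrbitalIntegral_loc_rationalComponent_eq_one_of_isAdmissibleOn`** — the SJ_H `h1` shape with invariance supplied by
  admissibility on the `G`-regular classes.

## References
* J. D. Rogawski, *Automorphic Representations of Unitary Groups in Three Variables*, Ann. of Math. Stud. 123 (1990), §4.3 pp. 42–44, §4.9 p. 54,
  §14.2 (14.2.1) p. 232 [Rogawski1990].
* R. E. Kottwitz, *Stable trace formula: elliptic singular terms*, Math. Ann. 275 (1986), Cor. 7.3 [Kottwitz1986].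
-/

set_option autoImplicit false

noncomputable section

open MeasureTheory NumberField IsDedekindDomain

namespace Literature.NumberTheory.Rogawski1990

open Literature.NumberTheory.Automorphic Literature.NumberTheory.Automorphic.UnitaryGroup

variable (L : Type) [Field L] [NumberField L] [IsCMField L]

/-! ## §1 `G`-regularity is a class function and localises -/

variable {L} in
/-- **`G`-regularity is a class function on `H(L⁺_v)`**: conjugate ⇒ stably conjugate (★ `isStablyConjH_of_isConj`) ⇒ same `p_{ι(·)}`
(★ `isGRegular_of_isStablyConjH`). [cite: Rogawski1990, §4.3 p. 42] -/
theorem isLocalGRegular_of_isConj {v : HeightOneSpectrum (𝓞 ↥(maximalRealSubfield L))}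
    {x x' : (UnitaryGroup.cmDatum L 2 (Matrix.of fun i j : Fin 2 => if i.val + j.val + 1 = 2 then (1 : L) else 0)).Local v ×
      (UnitaryGroup.cmDatum L 1 (Matrix.of fun i j : Fin 1 => if i.val + j.val + 1 = 1 then (1 : L) else 0)).Local v}
    (h : IsConj x x') (hx : IsLocalGRegular L v x) : IsLocalGRegular L v x' :=
  isGRegular_of_isStablyConjH _ _ _ _ (isStablyConjH_of_isConj h) hx

variable {L} in
/-- `x` `G`-regular ⇒ the class representative `out ⟦x⟧` is `G`-regular. [cite: Rogawski1990, §4.3 p. 42; §14.2 (14.2.1) p. 232] -/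
theorem isLocalGRegular_out_mk {v : HeightOneSpectrum (𝓞 ↥(maximalRealSubfield L))}
    {x : (UnitaryGroup.cmDatum L 2 (Matrix.of fun i j : Fin 2 => if i.val + j.val + 1 = 2 then (1 : L) else 0)).Local v ×
      (UnitaryGroup.cmDatum L 1 (Matrix.of fun i j : Fin 1 => if i.val + j.val + 1 = 1 then (1 : L) else 0)).Local v}
    (hx : IsLocalGRegular L v x) : IsLocalGRegular L v (Quotient.out (ConjClasses.mk x)) :=
  isLocalGRegular_of_isConj (isConj_out_conjClasses_mk x) hx

/-- **A rational `G`-regular `γ_H` is `G`-regular at every finite place** (★ `isLocalGRegular_toLocal_of_isGRegular`, spelled at ★ `rationalComponent`).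
[cite: Rogawski1990, §4.3 p. 42] -/
theorem isLocalGRegular_rationalComponent
    (γH : (UnitaryGroup.cmDatum L 2 (Matrix.of fun i j : Fin 2 => if i.val + j.val + 1 = 2 then (1 : L) else 0)).Rational ×
      (UnitaryGroup.cmDatum L 1 (Matrix.of fun i j : Fin 1 => if i.val + j.val + 1 = 1 then (1 : L) else 0)).Rational)
    (hreg : IsGRegular (cmConjRingHom L) (Matrix.of fun i j : Fin 2 => if i.val + j.val + 1 = 2 then (1 : L) else 0)
        (Matrix.of fun i j : Fin 1 => if i.val + j.val + 1 = 1 then (1 : L) else 0)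
        (Matrix.of fun i j : Fin 3 => if i.val + j.val + 1 = 3 then (1 : L) else 0) endoForm_antidiagOne γH)
    (v : HeightOneSpectrum (𝓞 ↥(maximalRealSubfield L))) : IsLocalGRegular L v (rationalComponent L γH v) :=
  isLocalGRegular_toLocal_of_isGRegular L γH hreg v

/-- **`out ⟦(γ_H)_v⟧` is `G`-regular** for a rational `G`-regular `γ_H` — the `hP v` input of ★ S-H
`exists_finset_forall_atPoint_rationalComponent_eq_one_of_isCanonical` at `P v := IsLocalGRegular L v`. [cite: Rogawski1990, §4.3 p. 42; §14.2 (14.2.1) p. 232] -/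
theorem isLocalGRegular_out_mk_rationalComponent
    (γH : (UnitaryGroup.cmDatum L 2 (Matrix.of fun i j : Fin 2 => if i.val + j.val + 1 = 2 then (1 : L) else 0)).Rational ×
      (UnitaryGroup.cmDatum L 1 (Matrix.of fun i j : Fin 1 => if i.val + j.val + 1 = 1 then (1 : L) else 0)).Rational)
    (hreg : IsGRegular (cmConjRingHom L) (Matrix.of fun i j : Fin 2 => if i.val + j.val + 1 = 2 then (1 : L) else 0)
        (Matrix.of fun i j : Fin 1 => if i.val + j.val + 1 = 1 then (1 : L) else 0)
        (Matrix.of fun i j : Fin 3 => if i.val + j.val + 1 = 3 then (1 : L) else 0) endoForm_antidiagOne γH)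
    (v : HeightOneSpectrum (𝓞 ↥(maximalRealSubfield L))) :
    IsLocalGRegular L v (Quotient.out (ConjClasses.mk (rationalComponent L γH v))) :=
  isLocalGRegular_out_mk (isLocalGRegular_rationalComponent L γH hreg v)

/-- **A rational `G`-regular `γ_H = (γ₂, γ₁)` has `γ₂ ∈ U(Φ₂)(L⁺)` regular** (★ `IsGRegular.isRegularElt_fst`). [cite: Rogawski1990, §4.3 p. 42] -/
theorem isRegularElt_fst_of_isGRegular
    (γH : (UnitaryGroup.cmDatum L 2 (Matrix.of fun i j : Fin 2 => if i.val + j.val + 1 = 2 then (1 : L) else 0)).Rational ×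
      (UnitaryGroup.cmDatum L 1 (Matrix.of fun i j : Fin 1 => if i.val + j.val + 1 = 1 then (1 : L) else 0)).Rational)
    (hreg : IsGRegular (cmConjRingHom L) (Matrix.of fun i j : Fin 2 => if i.val + j.val + 1 = 2 then (1 : L) else 0)
        (Matrix.of fun i j : Fin 1 => if i.val + j.val + 1 = 1 then (1 : L) else 0)
        (Matrix.of fun i j : Fin 3 => if i.val + j.val + 1 = 3 then (1 : L) else 0) endoForm_antidiagOne γH) :
    IsRegularElt (γH.1.val : GL (Fin 2) L) :=
  IsGRegular.isRegularElt_fst (σ := cmConjRingHom L) _ _ _ hreg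

/-! ## §2 The H-side `hadm` shape and the S-H theorems at the kit's pins -/

variable
  [∀ (v : HeightOneSpectrum (𝓞 ↥(maximalRealSubfield L)))
      (x : (UnitaryGroup.cmDatum L 2 (Matrix.of fun i j : Fin 2 => if i.val + j.val + 1 = 2 then (1 : L) else 0)).Local v ×
        (UnitaryGroup.cmDatum L 1 (Matrix.of fun i j : Fin 1 => if i.val + j.val + 1 = 1 then (1 : L) else 0)).Local v),
    MeasurableSpace (((UnitaryGroup.cmDatum L 2 (Matrix.of fun i j : Fin 2 => if i.val + j.val + 1 = 2 then (1 : L) else 0)).Local v ×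
        (UnitaryGroup.cmDatum L 1 (Matrix.of fun i j : Fin 1 => if i.val + j.val + 1 = 1 then (1 : L) else 0)).Local v) ⧸
      Subgroup.centralizer ({x} : Set ((UnitaryGroup.cmDatum L 2 (Matrix.of fun i j : Fin 2 => if i.val + j.val + 1 = 2 then (1 : L) else 0)).Local v ×
        (UnitaryGroup.cmDatum L 1 (Matrix.of fun i j : Fin 1 => if i.val + j.val + 1 = 1 then (1 : L) else 0)).Local v)))]

/-- **The H-side `hadm` shape**: `m^H_v` admissible on the `G`-regular classes is non-zero, invariant and finite on compacta at `⟦(γ_H)_v⟧` for a rational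
`G`-regular `γ_H` (★ `IsAdmissibleOn.at_mk`). [cite: Rogawski1990, §14.2 (14.2.1) p. 232; §4.9 p. 54] -/
theorem isAdmissibleOn_at_rationalComponent
    {mH : ∀ v : HeightOneSpectrum (𝓞 ↥(maximalRealSubfield L)),
      OrbitalMeasureFamily ((UnitaryGroup.cmDatum L 2 (Matrix.of fun i j : Fin 2 => if i.val + j.val + 1 = 2 then (1 : L) else 0)).Local v ×
        (UnitaryGroup.cmDatum L 1 (Matrix.of fun i j : Fin 1 => if i.val + j.val + 1 = 1 then (1 : L) else 0)).Local v)}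
    (v : HeightOneSpectrum (𝓞 ↥(maximalRealSubfield L))) (hadmH : (mH v).IsAdmissibleOn (IsLocalGRegular L v))
    (γH : (UnitaryGroup.cmDatum L 2 (Matrix.of fun i j : Fin 2 => if i.val + j.val + 1 = 2 then (1 : L) else 0)).Rational ×
      (UnitaryGroup.cmDatum L 1 (Matrix.of fun i j : Fin 1 => if i.val + j.val + 1 = 1 then (1 : L) else 0)).Rational)
    (hreg : IsGRegular (cmConjRingHom L) (Matrix.of fun i j : Fin 2 => if i.val + j.val + 1 = 2 then (1 : L) else 0)
        (Matrix.of fun i j : Fin 1 => if i.val + j.val + 1 = 1 then (1 : L) else 0)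
        (Matrix.of fun i j : Fin 3 => if i.val + j.val + 1 = 3 then (1 : L) else 0) endoForm_antidiagOne γH) :
    mH v (ConjClasses.mk (rationalComponent L γH v)) ≠ 0 ∧
      SMulInvariantMeasure
        ((UnitaryGroup.cmDatum L 2 (Matrix.of fun i j : Fin 2 => if i.val + j.val + 1 = 2 then (1 : L) else 0)).Local v ×
          (UnitaryGroup.cmDatum L 1 (Matrix.of fun i j : Fin 1 => if i.val + j.val + 1 = 1 then (1 : L) else 0)).Local v) _
        (mH v (ConjClasses.mk (rationalComponent L γH v))) ∧
      IsFiniteMeasureOnCompacts (mH v (ConjClasses.mk (rationalComponent L γH v))) :=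
  hadmH.at_mk _ (isLocalGRegular_out_mk_rationalComponent L γH hreg v)

variable
  [∀ (v : HeightOneSpectrum (𝓞 ↥(maximalRealSubfield L)))
      (x : (UnitaryGroup.cmDatum L 2 (Matrix.of fun i j : Fin 2 => if i.val + j.val + 1 = 2 then (1 : L) else 0)).Local v ×
        (UnitaryGroup.cmDatum L 1 (Matrix.of fun i j : Fin 1 => if i.val + j.val + 1 = 1 then (1 : L) else 0)).Local v),
    BorelSpace (((UnitaryGroup.cmDatum L 2 (Matrix.of fun i j : Fin 2 => if i.val + j.val + 1 = 2 then (1 : L) else 0)).Local v ×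
        (UnitaryGroup.cmDatum L 1 (Matrix.of fun i j : Fin 1 => if i.val + j.val + 1 = 1 then (1 : L) else 0)).Local v) ⧸
      Subgroup.centralizer ({x} : Set ((UnitaryGroup.cmDatum L 2 (Matrix.of fun i j : Fin 2 => if i.val + j.val + 1 = 2 then (1 : L) else 0)).Local v ×
        (UnitaryGroup.cmDatum L 1 (Matrix.of fun i j : Fin 1 => if i.val + j.val + 1 = 1 then (1 : L) else 0)).Local v)))]
  (mH : ∀ v : HeightOneSpectrum (𝓞 ↥(maximalRealSubfield L)),
    OrbitalMeasureFamily ((UnitaryGroup.cmDatum L 2 (Matrix.of fun i j : Fin 2 => if i.val + j.val + 1 = 2 then (1 : L) else 0)).Local v ×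
      (UnitaryGroup.cmDatum L 1 (Matrix.of fun i j : Fin 1 => if i.val + j.val + 1 = 1 then (1 : L) else 0)).Local v))

/-- **The SJ_H `h1` shape at the kit's pins**: for `m^H_v` admissible on the `G`-regular classes (invariance at `⟦(γ_H)_v⟧` supplied by §2), normalised
at `(γ_H)_v` off `S₀`, a rational `G`-regular `γ_H` and an unramified `T : PureTensor₂ L Φ₂ Φ₁`: `∃ S₂ ⊇ T.S, ∀ v ∉ S₂, Φ_v([(γ_H)_v], T.loc v) = 1`
(★ S-H `exists_finset_forall_classOrbitalIntegral_loc_rationalComponent_eq_one`). [cite: Rogawski1990, §4.3 p. 44; §4.9 p. 54] [cite: Kottwitz1986, Cor. 7.3] -/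
theorem exists_finset_forall_classOrbitalIntegral_loc_rationalComponent_eq_one_of_isAdmissibleOn
    (γH : (UnitaryGroup.cmDatum L 2 (Matrix.of fun i j : Fin 2 => if i.val + j.val + 1 = 2 then (1 : L) else 0)).Rational ×
      (UnitaryGroup.cmDatum L 1 (Matrix.of fun i j : Fin 1 => if i.val + j.val + 1 = 1 then (1 : L) else 0)).Rational)
    (hreg : IsGRegular (cmConjRingHom L) (Matrix.of fun i j : Fin 2 => if i.val + j.val + 1 = 2 then (1 : L) else 0)
        (Matrix.of fun i j : Fin 1 => if i.val + j.val + 1 = 1 then (1 : L) else 0)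
        (Matrix.of fun i j : Fin 3 => if i.val + j.val + 1 = 3 then (1 : L) else 0) endoForm_antidiagOne γH)
    (hadmH : ∀ v, (mH v).IsAdmissibleOn (IsLocalGRegular L v))
    {S₀ : Finset (HeightOneSpectrum (𝓞 ↥(maximalRealSubfield L)))}
    (hS₀ : ∀ v, v ∉ S₀ → (mH v).atPoint (rationalComponent L γH v)
      ((QuotientGroup.mk : _ → _) ''
        ((cmLocalIntegralLevel L 2 (Matrix.of fun i j : Fin 2 => if i.val + j.val + 1 = 2 then (1 : L) else 0) v :
            Set ((UnitaryGroup.cmDatum L 2 (Matrix.of fun i j : Fin 2 => if i.val + j.val + 1 = 2 then (1 : L) else 0)).Local v)) ×ˢ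
          (cmLocalIntegralLevel L 1 (Matrix.of fun i j : Fin 1 => if i.val + j.val + 1 = 1 then (1 : L) else 0) v :
            Set ((UnitaryGroup.cmDatum L 1 (Matrix.of fun i j : Fin 1 => if i.val + j.val + 1 = 1 then (1 : L) else 0)).Local v)))) = 1)
    (T : PureTensor₂ L (Matrix.of fun i j : Fin 2 => if i.val + j.val + 1 = 2 then (1 : L) else 0)
      (Matrix.of fun i j : Fin 1 => if i.val + j.val + 1 = 1 then (1 : L) else 0)) (hT : T.IsUnramified₂) :
    ∃ S₂ : Finset (HeightOneSpectrum (𝓞 ↥(maximalRealSubfield L))), T.S ⊆ S₂ ∧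
      ∀ v, v ∉ S₂ → classOrbitalIntegral (mH v) (T.loc v) (ConjClasses.mk (rationalComponent L γH v)) = 1 :=
  exists_finset_forall_classOrbitalIntegral_loc_rationalComponent_eq_one L mH γH (isRegularElt_fst_of_isGRegular L γH hreg)
    (fun v => (isAdmissibleOn_at_rationalComponent L v (hadmH v) γH hreg).2.1) hS₀ T hT

variable
  [∀ v : HeightOneSpectrum (𝓞 ↥(maximalRealSubfield L)),
    MeasurableSpace ((UnitaryGroup.cmDatum L 2 (Matrix.of fun i j : Fin 2 => if i.val + j.val + 1 = 2 then (1 : L) else 0)).Local v ×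
      (UnitaryGroup.cmDatum L 1 (Matrix.of fun i j : Fin 1 => if i.val + j.val + 1 = 1 then (1 : L) else 0)).Local v)]
  [∀ v : HeightOneSpectrum (𝓞 ↥(maximalRealSubfield L)),
    BorelSpace ((UnitaryGroup.cmDatum L 2 (Matrix.of fun i j : Fin 2 => if i.val + j.val + 1 = 2 then (1 : L) else 0)).Local v ×
      (UnitaryGroup.cmDatum L 1 (Matrix.of fun i j : Fin 1 => if i.val + j.val + 1 = 1 then (1 : L) else 0)).Local v)]

/-- **Canonical `m^H_v` for `(IsLocalGRegular, νH_v)` with `νH_v(K_{H,v}) = 1` are normalised at `(γ_H)_v` off a finite set**, for a rational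
`G`-regular `γ_H` — ★ S-H `exists_finset_forall_atPoint_rationalComponent_eq_one_of_isCanonical` at the kit's pin (xi‴), `hP` and the regularity of `γ₂`
discharged by §1. [cite: Rogawski1990, §4.3 (p. 43)] [cite: Kottwitz1986, Cor. 7.3] -/
theorem exists_finset_forall_atPoint_rationalComponent_eq_one_of_isCanonical_isLocalGRegular
    (νH : ∀ v : HeightOneSpectrum (𝓞 ↥(maximalRealSubfield L)),
      Measure ((UnitaryGroup.cmDatum L 2 (Matrix.of fun i j : Fin 2 => if i.val + j.val + 1 = 2 then (1 : L) else 0)).Local v ×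
        (UnitaryGroup.cmDatum L 1 (Matrix.of fun i j : Fin 1 => if i.val + j.val + 1 = 1 then (1 : L) else 0)).Local v))
    [∀ v, (νH v).IsHaarMeasure] [∀ v, (νH v).IsMulRightInvariant]
    (hν : ∀ v, νH v
      ((cmLocalIntegralLevel L 2 (Matrix.of fun i j : Fin 2 => if i.val + j.val + 1 = 2 then (1 : L) else 0) v :
          Set ((UnitaryGroup.cmDatum L 2 (Matrix.of fun i j : Fin 2 => if i.val + j.val + 1 = 2 then (1 : L) else 0)).Local v)) ×ˢ
        (cmLocalIntegralLevel L 1 (Matrix.of fun i j : Fin 1 => if i.val + j.val + 1 = 1 then (1 : L) else 0) v :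
          Set ((UnitaryGroup.cmDatum L 1 (Matrix.of fun i j : Fin 1 => if i.val + j.val + 1 = 1 then (1 : L) else 0)).Local v))) = 1)
    (hcan : ∀ v, (mH v).IsCanonical (IsLocalGRegular L v) (νH v))
    (γH : (UnitaryGroup.cmDatum L 2 (Matrix.of fun i j : Fin 2 => if i.val + j.val + 1 = 2 then (1 : L) else 0)).Rational ×
      (UnitaryGroup.cmDatum L 1 (Matrix.of fun i j : Fin 1 => if i.val + j.val + 1 = 1 then (1 : L) else 0)).Rational)
    (hreg : IsGRegular (cmConjRingHom L) (Matrix.of fun i j : Fin 2 => if i.val + j.val + 1 = 2 then (1 : L) else 0)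
        (Matrix.of fun i j : Fin 1 => if i.val + j.val + 1 = 1 then (1 : L) else 0)
        (Matrix.of fun i j : Fin 3 => if i.val + j.val + 1 = 3 then (1 : L) else 0) endoForm_antidiagOne γH) :
    ∃ S₀ : Finset (HeightOneSpectrum (𝓞 ↥(maximalRealSubfield L))), ∀ v, v ∉ S₀ → (mH v).atPoint (rationalComponent L γH v)
      ((QuotientGroup.mk : _ → _) ''
        ((cmLocalIntegralLevel L 2 (Matrix.of fun i j : Fin 2 => if i.val + j.val + 1 = 2 then (1 : L) else 0) v :
            Set ((UnitaryGroup.cmDatum L 2 (Matrix.of fun i j : Fin 2 => if i.val + j.val + 1 = 2 then (1 : L) else 0)).Local v)) ×ˢ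
          (cmLocalIntegralLevel L 1 (Matrix.of fun i j : Fin 1 => if i.val + j.val + 1 = 1 then (1 : L) else 0) v :
            Set ((UnitaryGroup.cmDatum L 1 (Matrix.of fun i j : Fin 1 => if i.val + j.val + 1 = 1 then (1 : L) else 0)).Local v)))) = 1 :=
  exists_finset_forall_atPoint_rationalComponent_eq_one_of_isCanonical L mH (fun v => IsLocalGRegular L v) νH hν hcan γH
    (isRegularElt_fst_of_isGRegular L γH hreg) fun v => isLocalGRegular_out_mk_rationalComponent L γH hreg v

end Literature.NumberTheory.Rogawski1990

end
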